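import Mathlib
import HarnessLib
import Summits.RiemannHypothesis.RiemannHypothesis.Theorems.IntegerScrewFloorLaplace
import Summits.RiemannHypothesis.RiemannHypothesis.Theorems.IntegerScrewCSharpUpper
import Summits.RiemannHypothesis.RiemannHypothesis.Theorems.IntegerScrewWindowIntegral

/-!
# Route `IntegerScrew` — THEOREM N6₁ (PIVOT-LAW 13.45), part 1: the pointwise sandwich for `(e^{tN_M})₁₁` and the
# two explicit integral estimates for `1/f_M(L+s)` with a free cut `T` (window / middle / tail)

`f_M(a) = windowFloor M a` is the per-window floor of the intercept problem (PIVOT-LAW §13.3;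
`IntegerScrewCouplingDefs`).  THEOREM N6₁ says that at the heights `a = log M + s` the floor is
`log M/(log log M + O(log log log M))`.  The proof is PIVOT-LAW 13.45's one line each way, assembled from
kernel objects only:

* `1/f_M(L+s) = ∫₀^∞ e^{−(L+s)t}(e^{tN_M})₁₁dt` (`IntegerScrewFloorLaplace`, PROP. N2 for `(L+s)I − N_M ≻ 0`);
* the Feynman–Kac sandwich `e^{(L−6)t}p⁰₁₁(tL) ≤ (e^{tN_M})₁₁ ≤ e^{(L+6)t}p⁰₁₁(tL)` (`IntegerScrewCouplingDoob`);
* THEOREM C♯ `e^{−16τ/L}g(τ) ≤ p⁰₁₁(τ) ≤ e^{65τ/L}g(τ)` (`IntegerScrewCSharpUpper.returnProb_csharp`);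
* the window integral `log T − 1 ≤ ∫₀^T g ≤ 1 + log T` and `g ≤ 1/τ` (`IntegerScrewWindowIntegral`,
  `IntegerScrewHarmonicK`);
* the spectral tail `(e^{(t+1)N_M})₁₁ ≤ e^{νt}(e^{N_M})₁₁`, `ν = log M − γ/2` (`IntegerScrewFloorLaplace`).

Results of this part (`L = log M`): `exp_neg_mul_coupling_ge/_le` (e^{−22t}g(tL) ≤ e^{−Lt}(e^{tN_M})₁₁ ≤
e^{71t}g(tL)), `coupling_exp_one_le`, `coupling_exp_tail_le`, and the estimates
`windowFloor_inv_ge`: `e^{−(s+22)T}(log(LT) − 1)/L ≤ 1/f_M(L+s)` and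
`windowFloor_inv_le`: `1/f_M(L+s) ≤ [e^{71T}(1 + log(LT)) + e^{71}log(1/T) + 4e^{72}]/L` (`0 < T ≤ 1 ≤ LT`).
The asymptotic statements (THEOREM N6₁) are in `IntegerScrewN6One`.

RH-free (`N_M` and the walk are arithmetic objects); nothing here bears on the truth of RH.  References:
PIVOT-LAW §13.45, CONTINUUM-LIMIT §17 (rh-explicit A6-PIVOT); M. Suzuki, J. Lond. Math. Soc. (2) 108 (2023)
1448–1487 [Suzuki2023] for the screw matrices whose intercept energy `f_M` bounds (THEOREM 8).
-/

noncomputable section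

-- D-0017: `Summit.<S>.<S>.…` is the designed namespace of a single-problem summit.
set_option linter.dupNamespace false

namespace Summit.RiemannHypothesis.RiemannHypothesis.Theorems.IntegerScrew

open scoped Matrix.Norms.Operator
open NormedSpace Matrix Finset Filter MeasureTheory Set

/-! ### Pointwise bounds for `(e^{tN_M})₁₁` from the sandwich and THEOREM C♯ -/

section Pointwise

variable {M : ℕ}

/-- The state `1` of `IntegerScrewReturnTransfer.stOne` is `⟨1, _⟩`. -/
theorem stOne_eq_mk (hM : 1 ≤ M) (h1 : 1 ∈ Finset.Icc 1 M) : (stOne hM : St M) = ⟨1, h1⟩ := rfl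

/-- **Window lower bound**: `e^{−22t}·g(tL) ≤ e^{−Lt}(e^{tN_M})₁₁` (`t > 0`, `M ≥ 2`, `L = log M`). -/
theorem exp_neg_mul_coupling_ge (hM : 2 ≤ M) (h1 : 1 ∈ Finset.Icc 1 M) {t : ℝ} (ht : 0 < t) :
    Real.exp (-(22 * t)) * ccpg (t * Real.log M) ≤
      Real.exp (-(Real.log M * t)) * (exp (t • couplingMatrix M)) ⟨1, h1⟩ ⟨1, h1⟩ := by
  have hL : 0 < Real.log M := Real.log_pos (by exact_mod_cast hM)
  have hτ : 0 < t * Real.log M := mul_pos ht hL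
  have hD := exp_couplingMatrix_apply_self_ge hM ht.le (⟨1, h1⟩ : St M)
  have hC := (returnProb_csharp hM hτ).1
  rw [stOne_eq_mk (by omega) h1] at hC
  have e16 : -(16 / Real.log M * (t * Real.log M)) = -(16 * t) := by
    field_simp
  rw [e16] at hC
  have hg : 0 ≤ ccpg (t * Real.log M) := (ccpg_pos hτ).le
  calc Real.exp (-(22 * t)) * ccpg (t * Real.log M)
      = Real.exp (-(Real.log M * t)) * (Real.exp ((Real.log M - 6) * t) *
          (Real.exp (-(16 * t)) * ccpg (t * Real.log M))) := by
        rw [← mul_assoc, ← mul_assoc, ← Real.exp_add, ← Real.exp_add]; ring_nf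
    _ ≤ Real.exp (-(Real.log M * t)) * (Real.exp ((Real.log M - 6) * t) *
          (exp ((t * Real.log M) • walkGen M)) ⟨1, h1⟩ ⟨1, h1⟩) :=
        mul_le_mul_of_nonneg_left (mul_le_mul_of_nonneg_left hC (Real.exp_pos _).le) (Real.exp_pos _).le
    _ ≤ Real.exp (-(Real.log M * t)) * (exp (t • couplingMatrix M)) ⟨1, h1⟩ ⟨1, h1⟩ :=
        mul_le_mul_of_nonneg_left hD (Real.exp_pos _).le

/-- **Window/middle upper bound**: `e^{−Lt}(e^{tN_M})₁₁ ≤ e^{71t}·g(tL)` (`t > 0`, `M ≥ 2`). -/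
theorem exp_neg_mul_coupling_le (hM : 2 ≤ M) (h1 : 1 ∈ Finset.Icc 1 M) {t : ℝ} (ht : 0 < t) :
    Real.exp (-(Real.log M * t)) * (exp (t • couplingMatrix M)) ⟨1, h1⟩ ⟨1, h1⟩ ≤
      Real.exp (71 * t) * ccpg (t * Real.log M) := by
  have hL : 0 < Real.log M := Real.log_pos (by exact_mod_cast hM)
  have hτ : 0 < t * Real.log M := mul_pos ht hL
  have hD := exp_couplingMatrix_apply_self_le hM ht.le (⟨1, h1⟩ : St M)
  have hC := (returnProb_csharp hM hτ).2
  rw [stOne_eq_mk (by omega) h1] at hC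
  have e65 : 65 / Real.log M * (t * Real.log M) = 65 * t := by
    field_simp
  rw [e65] at hC
  calc Real.exp (-(Real.log M * t)) * (exp (t • couplingMatrix M)) ⟨1, h1⟩ ⟨1, h1⟩
      ≤ Real.exp (-(Real.log M * t)) * (Real.exp ((Real.log M + 6) * t) *
          (exp ((t * Real.log M) • walkGen M)) ⟨1, h1⟩ ⟨1, h1⟩) :=
        mul_le_mul_of_nonneg_left hD (Real.exp_pos _).le
    _ ≤ Real.exp (-(Real.log M * t)) * (Real.exp ((Real.log M + 6) * t) *
          (Real.exp (65 * t) * ccpg (t * Real.log M))) :=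
        mul_le_mul_of_nonneg_left (mul_le_mul_of_nonneg_left hC (Real.exp_pos _).le) (Real.exp_pos _).le
    _ = Real.exp (71 * t) * ccpg (t * Real.log M) := by
        rw [← mul_assoc, ← mul_assoc, ← Real.exp_add, ← Real.exp_add]; ring_nf

/-- `(e^{N_M})₁₁ ≤ e^{L+71}/L` (`M ≥ 2`). -/
theorem coupling_exp_one_le (hM : 2 ≤ M) (h1 : 1 ∈ Finset.Icc 1 M) :
    (exp ((1 : ℝ) • couplingMatrix M)) ⟨1, h1⟩ ⟨1, h1⟩ ≤
      Real.exp (Real.log M + 71) / Real.log M := by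
  have hL : 0 < Real.log M := Real.log_pos (by exact_mod_cast hM)
  have h := exp_neg_mul_coupling_le hM h1 one_pos
  rw [mul_one, mul_one, one_mul] at h
  have hg : ccpg (Real.log M) ≤ 1 / Real.log M := ccpg_le_inv hL
  have h2 : Real.exp (-Real.log M) * (exp ((1 : ℝ) • couplingMatrix M)) ⟨1, h1⟩ ⟨1, h1⟩ ≤
      Real.exp 71 * (1 / Real.log M) :=
    h.trans (mul_le_mul_of_nonneg_left hg (Real.exp_pos _).le)
  have h3 := mul_le_mul_of_nonneg_left h2 (Real.exp_pos (Real.log M)).le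
  rw [← mul_assoc, ← Real.exp_add, add_neg_cancel, Real.exp_zero, one_mul, ← mul_assoc,
    ← Real.exp_add] at h3
  rw [div_eq_mul_one_div]
  exact h3

/-- **Tail bound**: with the form bound `ν`, `(e^{tN_M})₁₁ ≤ e^{ν(t−1)}·e^{L+71}/L` for `t ≥ 1`. -/
theorem coupling_exp_tail_le (hM : 2 ≤ M) (h1 : 1 ∈ Finset.Icc 1 M) {ν : ℝ}
    (hform : ∀ v : St M → ℝ, v ⬝ᵥ (couplingMatrix M *ᵥ v) ≤ ν * (v ⬝ᵥ v)) {t : ℝ} (ht : 1 ≤ t) :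
    (exp (t • couplingMatrix M)) ⟨1, h1⟩ ⟨1, h1⟩ ≤
      Real.exp (ν * (t - 1)) * (Real.exp (Real.log M + 71) / Real.log M) := by
  have h := exp_couplingMatrix_apply_self_le_tail hform (sub_nonneg.2 ht) (⟨1, h1⟩ : St M)
  rw [sub_add_cancel] at h
  exact h.trans (mul_le_mul_of_nonneg_left (coupling_exp_one_le hM h1) (Real.exp_pos _).le)

end Pointwise

/-! ### Integrability of the comparison functions -/

/-- `t ↦ e^{ct}·g(tL)` is integrable on `(0, T]` (bounded by `max(1, e^{cT})`, measurable). -/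
theorem integrableOn_exp_mul_ccpg (c L T : ℝ) (hL : 0 < L) :
    IntegrableOn (fun t : ℝ => Real.exp (c * t) * ccpg (t * L)) (Ioc 0 T) := by
  have hmeas : Measurable fun t : ℝ => Real.exp (c * t) * ccpg (t * L) :=
    (Real.continuous_exp.comp (continuous_const.mul continuous_id)).measurable.mul
      (measurable_ccpg.comp (measurable_id.mul_const L))
  refine Measure.integrableOn_of_bounded (M := max 1 (Real.exp (c * T))) measure_Ioc_lt_top.ne
    hmeas.aestronglyMeasurable ?_
  refine (ae_restrict_iff' measurableSet_Ioc).2 (Filter.Eventually.of_forall fun t ht => ?_)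
  have hg0 : 0 ≤ ccpg (t * L) := (ccpg_pos (mul_pos ht.1 hL)).le
  have hg1 : ccpg (t * L) ≤ 1 := ccpg_le_one (mul_pos ht.1 hL)
  rw [Real.norm_of_nonneg (mul_nonneg (Real.exp_pos _).le hg0)]
  have hexp : Real.exp (c * t) ≤ max 1 (Real.exp (c * T)) := by
    rcases le_or_gt 0 c with hc | hc
    · exact (Real.exp_le_exp.2 (mul_le_mul_of_nonneg_left ht.2 hc)).trans (le_max_right _ _)
    · refine le_trans ?_ (le_max_left _ _)
      rw [Real.exp_le_one_iff]
      nlinarith [ht.1]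
  calc Real.exp (c * t) * ccpg (t * L) ≤ Real.exp (c * t) * 1 := mul_le_mul_of_nonneg_left hg1 (Real.exp_pos _).le
    _ ≤ max 1 (Real.exp (c * T)) := by rw [mul_one]; exact hexp

/-- The window integral in the `t = τ/L` variable: `∫₀^T g(tL)dt = (∫₀^{LT} g)/L`. -/
theorem integral_ccpg_comp_mul {L : ℝ} (hL : 0 < L) (T : ℝ) :
    ∫ t in (0 : ℝ)..T, ccpg (t * L) = (∫ τ in (0 : ℝ)..L * T, ccpg τ) / L := by
  have h := intervalIntegral.integral_comp_mul_left ccpg hL.ne' (a := 0) (b := T)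
  simp only [mul_zero] at h
  rw [show (fun t : ℝ => ccpg (t * L)) = fun t => ccpg (L * t) by funext t; rw [mul_comm]]
  rw [h, smul_eq_mul, div_eq_inv_mul]

/-! ### The two integral estimates with a free cut `T` -/

section Estimates

variable {M : ℕ}

/-- **Lower estimate**: for `M ≥ 2`, `s ≥ 0`, a form bound `ν < L + s` and a cut `T > 0` with `LT ≥ 1`:
`e^{−(s+22)T}·(log(LT) − 1)/L ≤ 1/f_M(L+s)`. -/
theorem windowFloor_inv_ge (hM : 2 ≤ M) (h1 : 1 ∈ Finset.Icc 1 M) {s : ℝ} (hs : 0 ≤ s) {ν : ℝ}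
    (hform : ∀ v : St M → ℝ, v ⬝ᵥ (couplingMatrix M *ᵥ v) ≤ ν * (v ⬝ᵥ v))
    (hν : ν < Real.log M + s) {T : ℝ} (hT : 0 < T) (hLT : 1 ≤ Real.log M * T) :
    Real.exp (-((s + 22) * T)) * (Real.log (Real.log M * T) - 1) / Real.log M ≤
      (windowFloor M (Real.log M + s))⁻¹ := by
  set L : ℝ := Real.log M with hLdef
  have hL : 0 < L := Real.log_pos (by exact_mod_cast hM)
  set φ : ℝ → ℝ := fun t => Real.exp (-((L + s) * t)) * (exp (t • couplingMatrix M)) ⟨1, h1⟩ ⟨1, h1⟩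
    with hφ
  rw [windowFloor_inv_eq_integral h1 hform hν]
  change _ ≤ ∫ t in Ioi (0 : ℝ), φ t
  -- integrability and positivity of φ
  have hint : IntegrableOn φ (Ioi 0) :=
    (laplaceHyp_of_form_le (couplingMatrix_isHermitian M) hform hν).1 ⟨1, h1⟩ ⟨1, h1⟩
  have hpos : ∀ t, 0 ≤ φ t := fun t =>
    mul_nonneg (Real.exp_pos _).le (exp_couplingMatrix_apply_self_nonneg M t _)
  -- restrict to the window (0, T]
  have hsub : ∫ t in Ioc (0 : ℝ) T, φ t ≤ ∫ t in Ioi (0 : ℝ), φ t :=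
    setIntegral_mono_set hint (Filter.Eventually.of_forall hpos) (Filter.Eventually.of_forall Set.Ioc_subset_Ioi_self)
  refine le_trans ?_ hsub
  -- on the window: φ(t) ≥ e^{−(s+22)T}·g(tL)
  set ψ : ℝ → ℝ := fun t => Real.exp (-((s + 22) * T)) * ccpg (t * L) with hψ
  have hψint : IntegrableOn ψ (Ioc 0 T) := by
    have h := (integrableOn_exp_mul_ccpg 0 L T hL).const_mul (Real.exp (-((s + 22) * T)))
    refine IntegrableOn.congr_fun h (fun t _ => ?_) measurableSet_Ioc
    simp only [hψ, zero_mul, Real.exp_zero, one_mul]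
  have hle : ∀ t ∈ Ioc (0 : ℝ) T, ψ t ≤ φ t := by
    intro t ht
    have h := exp_neg_mul_coupling_ge hM h1 ht.1
    have hg : 0 ≤ ccpg (t * L) := (ccpg_pos (mul_pos ht.1 hL)).le
    -- e^{−(s+22)T} g ≤ e^{−(s+22)t} g = e^{−st}·e^{−22t}g ≤ e^{−st}·e^{−Lt}E = φ
    have h2 : Real.exp (-((s + 22) * T)) ≤ Real.exp (-((s + 22) * t)) :=
      Real.exp_le_exp.2 (by nlinarith [ht.2])
    calc ψ t ≤ Real.exp (-((s + 22) * t)) * ccpg (t * L) := mul_le_mul_of_nonneg_right h2 hg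
      _ = Real.exp (-(s * t)) * (Real.exp (-(22 * t)) * ccpg (t * L)) := by
          rw [← mul_assoc, ← Real.exp_add]; ring_nf
      _ ≤ Real.exp (-(s * t)) * (Real.exp (-(L * t)) * (exp (t • couplingMatrix M)) ⟨1, h1⟩ ⟨1, h1⟩) :=
          mul_le_mul_of_nonneg_left h (Real.exp_pos _).le
      _ = φ t := by rw [hφ]; dsimp only; rw [← mul_assoc, ← Real.exp_add]; ring_nf
  have hmono : ∫ t in Ioc (0 : ℝ) T, ψ t ≤ ∫ t in Ioc (0 : ℝ) T, φ t :=
    setIntegral_mono_on hψint (hint.mono_set Set.Ioc_subset_Ioi_self) measurableSet_Ioc hle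
  refine le_trans ?_ hmono
  -- evaluate the window integral of ψ
  have hval : ∫ t in Ioc (0 : ℝ) T, ψ t = Real.exp (-((s + 22) * T)) * ((∫ τ in (0 : ℝ)..L * T, ccpg τ) / L) := by
    rw [← intervalIntegral.integral_of_le hT.le, hψ, intervalIntegral.integral_const_mul,
      integral_ccpg_comp_mul hL]
  rw [hval, mul_div_assoc]
  refine mul_le_mul_of_nonneg_left ?_ (Real.exp_pos _).le
  exact div_le_div_of_nonneg_right (log_sub_one_le_integral_ccpg hLT) hL.le

/-- **Upper estimate**: for `M ≥ 2`, `s ≥ 0`, the form bound `ν = L − γ/2` and a cut `0 < T ≤ 1` with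
`LT ≥ 1`: `1/f_M(L+s) ≤ [e^{71T}(1 + log(LT)) + e^{71}·log(1/T) + 4e^{72}]/L`. -/
theorem windowFloor_inv_le (hM : 2 ≤ M) (h1 : 1 ∈ Finset.Icc 1 M) {s : ℝ} (hs : 0 ≤ s)
    (hform : ∀ v : St M → ℝ, v ⬝ᵥ (couplingMatrix M *ᵥ v) ≤
      (Real.log M - Real.eulerMascheroniConstant / 2) * (v ⬝ᵥ v))
    {T : ℝ} (hT : 0 < T) (hT1 : T ≤ 1) (hLT : 1 ≤ Real.log M * T) :
    (windowFloor M (Real.log M + s))⁻¹ ≤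
      (Real.exp (71 * T) * (1 + Real.log (Real.log M * T)) + Real.exp 71 * Real.log (1 / T) +
        4 * Real.exp 72) / Real.log M := by
  set L : ℝ := Real.log M with hLdef
  set γ : ℝ := Real.eulerMascheroniConstant with hγdef
  have hγ0 : 1 / 2 < γ := by rw [hγdef]; exact Real.one_half_lt_eulerMascheroniConstant
  have hγ1 : γ < 2 / 3 := by rw [hγdef]; exact Real.eulerMascheroniConstant_lt_two_thirds
  have hL : 0 < L := Real.log_pos (by exact_mod_cast hM)
  have hν : L - γ / 2 < L + s := by linarith
  set φ : ℝ → ℝ := fun t => Real.exp (-((L + s) * t)) * (exp (t • couplingMatrix M)) ⟨1, h1⟩ ⟨1, h1⟩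
    with hφ
  rw [windowFloor_inv_eq_integral h1 hform hν]
  change (∫ t in Ioi (0 : ℝ), φ t) ≤ _
  have hint : IntegrableOn φ (Ioi 0) :=
    (laplaceHyp_of_form_le (couplingMatrix_isHermitian M) hform hν).1 ⟨1, h1⟩ ⟨1, h1⟩
  -- split (0,∞) = (0,T] ∪ (T,1] ∪ (1,∞)
  have hsplit1 : ∫ t in Ioi (0 : ℝ), φ t = (∫ t in Ioc (0 : ℝ) 1, φ t) + ∫ t in Ioi (1 : ℝ), φ t := by
    rw [← setIntegral_union (Set.Ioc_disjoint_Ioi le_rfl) measurableSet_Ioi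
      (hint.mono_set Set.Ioc_subset_Ioi_self) (hint.mono_set (Ioi_subset_Ioi zero_le_one)),
      Ioc_union_Ioi_eq_Ioi zero_le_one]
  have hsplit2 : ∫ t in Ioc (0 : ℝ) 1, φ t = (∫ t in Ioc (0 : ℝ) T, φ t) + ∫ t in Ioc T 1, φ t := by
    rw [← setIntegral_union (Set.Ioc_disjoint_Ioc_of_le le_rfl) measurableSet_Ioc
      (hint.mono_set Set.Ioc_subset_Ioi_self)
      (hint.mono_set ((Set.Ioc_subset_Ioi_self).trans (Ioi_subset_Ioi hT.le))),
      Ioc_union_Ioc_eq_Ioc hT.le hT1]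
  rw [hsplit1, hsplit2]
  -- (i) the window (0, T]
  have hwin : ∫ t in Ioc (0 : ℝ) T, φ t ≤ Real.exp (71 * T) * (1 + Real.log (L * T)) / L := by
    set ψ : ℝ → ℝ := fun t => Real.exp (71 * T) * ccpg (t * L) with hψ
    have hψint : IntegrableOn ψ (Ioc 0 T) := by
      have h := (integrableOn_exp_mul_ccpg 0 L T hL).const_mul (Real.exp (71 * T))
      refine IntegrableOn.congr_fun h (fun t _ => ?_) measurableSet_Ioc
      simp only [hψ, zero_mul, Real.exp_zero, one_mul]
    have hle : ∀ t ∈ Ioc (0 : ℝ) T, φ t ≤ ψ t := by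
      intro t ht
      have h := exp_neg_mul_coupling_le hM h1 ht.1
      have hg : 0 ≤ ccpg (t * L) := (ccpg_pos (mul_pos ht.1 hL)).le
      have hφt : φ t = Real.exp (-(s * t)) * (Real.exp (-(L * t)) *
          (exp (t • couplingMatrix M)) ⟨1, h1⟩ ⟨1, h1⟩) := by
        rw [hφ]; dsimp only; rw [← mul_assoc, ← Real.exp_add]; ring_nf
      rw [hφt]
      have hs1 : Real.exp (-(s * t)) ≤ 1 := by
        rw [Real.exp_le_one_iff]; nlinarith [ht.1]
      calc Real.exp (-(s * t)) * (Real.exp (-(L * t)) * (exp (t • couplingMatrix M)) ⟨1, h1⟩ ⟨1, h1⟩)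
          ≤ 1 * (Real.exp (71 * t) * ccpg (t * L)) :=
            mul_le_mul hs1 h (mul_nonneg (Real.exp_pos _).le (exp_couplingMatrix_apply_self_nonneg M t _))
              zero_le_one
        _ ≤ ψ t := by
            rw [one_mul, hψ]
            exact mul_le_mul_of_nonneg_right (Real.exp_le_exp.2 (by nlinarith [ht.2])) hg
    have hmono := setIntegral_mono_on (hint.mono_set Set.Ioc_subset_Ioi_self) hψint measurableSet_Ioc hle
    refine hmono.trans ?_
    have hval : ∫ t in Ioc (0 : ℝ) T, ψ t = Real.exp (71 * T) * ((∫ τ in (0 : ℝ)..L * T, ccpg τ) / L) := by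
      rw [← intervalIntegral.integral_of_le hT.le, hψ, intervalIntegral.integral_const_mul,
        integral_ccpg_comp_mul hL]
    rw [hval, mul_div_assoc]
    refine mul_le_mul_of_nonneg_left ?_ (Real.exp_pos _).le
    exact div_le_div_of_nonneg_right (integral_ccpg_le hLT) hL.le
  -- (ii) the middle range (T, 1]
  have hmid : ∫ t in Ioc T 1, φ t ≤ Real.exp 71 * Real.log (1 / T) / L := by
    set ψ : ℝ → ℝ := fun t => Real.exp 71 / L * (1 / t) with hψ
    have hcont : ContinuousOn (fun t : ℝ => 1 / t) (uIcc T 1) := by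
      refine continuousOn_const.div continuousOn_id fun x hx => ?_
      rw [uIcc_of_le hT1] at hx
      exact ne_of_gt (lt_of_lt_of_le hT hx.1)
    have hψint : IntegrableOn ψ (Ioc T 1) := by
      have h := (hcont.intervalIntegrable (μ := volume)).const_mul (Real.exp 71 / L)
      exact (intervalIntegrable_iff_integrableOn_Ioc_of_le hT1).1 h
    have hle : ∀ t ∈ Ioc T 1, φ t ≤ ψ t := by
      intro t ht
      have ht0 : 0 < t := lt_trans hT ht.1
      have h := exp_neg_mul_coupling_le hM h1 ht0
      have hg : ccpg (t * L) ≤ 1 / (t * L) := ccpg_le_inv (mul_pos ht0 hL)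
      have hφt : φ t = Real.exp (-(s * t)) * (Real.exp (-(L * t)) *
          (exp (t • couplingMatrix M)) ⟨1, h1⟩ ⟨1, h1⟩) := by
        rw [hφ]; dsimp only; rw [← mul_assoc, ← Real.exp_add]; ring_nf
      rw [hφt]
      have hs1 : Real.exp (-(s * t)) ≤ 1 := by
        rw [Real.exp_le_one_iff]; nlinarith [ht0]
      have h71 : Real.exp (71 * t) ≤ Real.exp 71 := Real.exp_le_exp.2 (by nlinarith [ht.2])
      calc Real.exp (-(s * t)) * (Real.exp (-(L * t)) * (exp (t • couplingMatrix M)) ⟨1, h1⟩ ⟨1, h1⟩)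
          ≤ 1 * (Real.exp (71 * t) * ccpg (t * L)) :=
            mul_le_mul hs1 h (mul_nonneg (Real.exp_pos _).le (exp_couplingMatrix_apply_self_nonneg M t _))
              zero_le_one
        _ ≤ Real.exp 71 * (1 / (t * L)) := by
            rw [one_mul]
            exact mul_le_mul h71 hg (ccpg_pos (mul_pos ht0 hL)).le (Real.exp_pos _).le
        _ = ψ t := by rw [hψ]; field_simp
    have hmono := setIntegral_mono_on (hint.mono_set ((Set.Ioc_subset_Ioi_self).trans (Ioi_subset_Ioi hT.le)))
      hψint measurableSet_Ioc hle
    refine hmono.trans (le_of_eq ?_)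
    have h0 : (0 : ℝ) ∉ uIcc T 1 := by
      rw [uIcc_of_le hT1]; intro h; exact absurd h.1 (not_le.2 hT)
    rw [← intervalIntegral.integral_of_le hT1, hψ, intervalIntegral.integral_const_mul, integral_one_div h0]
    field_simp
  -- (iii) the tail (1, ∞)
  have htail : ∫ t in Ioi (1 : ℝ), φ t ≤ 4 * Real.exp 72 / L := by
    set K : ℝ := Real.exp (72 : ℝ) / L with hK
    set ψ : ℝ → ℝ := fun t => K * Real.exp (-(γ / 2) * t) with hψ
    have hψint : IntegrableOn ψ (Ioi 1) := (exp_neg_integrableOn_Ioi 1 (by linarith)).const_mul K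
    have hle : ∀ t ∈ Ioi (1 : ℝ), φ t ≤ ψ t := by
      intro t ht
      have ht1 : 1 ≤ t := le_of_lt ht
      have h := coupling_exp_tail_le hM h1 hform ht1
      rw [← hLdef] at h
      have hE0 := exp_couplingMatrix_apply_self_nonneg M t (⟨1, h1⟩ : St M)
      rw [hφ]; dsimp only
      -- e^{−(L+s)t}·e^{(L−γ/2)(t−1)}·e^{L+71}/L ≤ (e^{72}/L)e^{−(γ/2)t}
      calc Real.exp (-((L + s) * t)) * (exp (t • couplingMatrix M)) ⟨1, h1⟩ ⟨1, h1⟩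
          ≤ Real.exp (-((L + s) * t)) * (Real.exp ((L - γ / 2) * (t - 1)) * (Real.exp (L + 71) / L)) :=
            mul_le_mul_of_nonneg_left h (Real.exp_pos _).le
        _ = Real.exp (-((L + s) * t) + (L - γ / 2) * (t - 1) + (L + 71)) / L := by
            simp only [Real.exp_add]; ring
        _ ≤ Real.exp (72 + -(γ / 2) * t) / L := by
            refine div_le_div_of_nonneg_right (Real.exp_le_exp.2 ?_) hL.le
            nlinarith [ht1, hs, hγ1]
        _ = ψ t := by rw [Real.exp_add, hψ, hK]; ring
    have hmono := setIntegral_mono_on (hint.mono_set (Ioi_subset_Ioi zero_le_one)) hψint measurableSet_Ioi hle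
    refine hmono.trans ?_
    have hval : ∫ t in Ioi (1 : ℝ), ψ t = K * (-Real.exp (-(γ / 2) * 1) / (-(γ / 2))) := by
      rw [hψ, integral_const_mul, integral_exp_mul_Ioi (by linarith) 1]
    rw [hval]
    have hq : -Real.exp (-(γ / 2) * 1) / (-(γ / 2)) = Real.exp (-(γ / 2)) * (2 / γ) := by
      field_simp
    rw [hq]
    have h2 : Real.exp (-(γ / 2)) * (2 / γ) ≤ 4 := by
      have he : Real.exp (-(γ / 2)) ≤ 1 := by rw [Real.exp_le_one_iff]; linarith
      have hg : 2 / γ ≤ 4 := by rw [div_le_iff₀ (by linarith)]; linarith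
      calc Real.exp (-(γ / 2)) * (2 / γ) ≤ 1 * 4 := mul_le_mul he hg (by positivity) zero_le_one
        _ = 4 := one_mul _
    have hK0 : 0 ≤ K := by rw [hK]; positivity
    calc K * (Real.exp (-(γ / 2)) * (2 / γ)) ≤ K * 4 := mul_le_mul_of_nonneg_left h2 hK0
      _ = 4 * Real.exp 72 / L := by rw [hK]; ring
  -- sum up
  have hsum : (∫ t in Ioc (0 : ℝ) T, φ t) + (∫ t in Ioc T 1, φ t) + ∫ t in Ioi (1 : ℝ), φ t ≤
      Real.exp (71 * T) * (1 + Real.log (L * T)) / L + Real.exp 71 * Real.log (1 / T) / L + 4 * Real.exp 72 / L :=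
    add_le_add (add_le_add hwin hmid) htail
  rw [← add_div, ← add_div] at hsum
  exact hsum

end Estimates


end Summit.RiemannHypothesis.RiemannHypothesis.Theorems.IntegerScrew

end
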